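import Summits.SmoothPoincare4.SmoothPoincare4.Theorems.CongruenceShadowsAgkCor6SufficiencyGeomMarkingDefs
import Literature.Topology.FourManifolds.FlowerMarkingTransport
import Literature.Topology.FourManifolds.TrisectionCentralSurfaceMarking
import Literature.Topology.FourManifolds.FlowerMelon
import Literature.Topology.FourManifolds.OneHandleStepExists
import HarnessLib

/-!
# Stub `stub_centralSurfaceFlower` of line `lp-by-sphere-system-surgery` for crux `AgkCor6Sufficiency`
(item stmt-SmoothPoincare4-10894, routes `CongruenceShadows` / `GroupTrisection`; lead reshape r6b)

**The central surface of a balanced genus-`g ≥ 2` Gay–Kirby trisection is homeomorphic to the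
flower surface** `FlowerModel.flowerSurface g = {q_g(x, y) + z² = c_g} ⊂ ℝ³` (the boundary of
Juhász's flower handlebody `V_g`, the tree's model genus-`g` handlebody for `g ≥ 2`).

Proof (the assembly of `TrisectionCentralSurfaceMarking.lean` /
`FlowerMarkingTransport.lean`, with homeomorphisms in place of markings):
clause (iii) of the trisection gives a genus-`g` handlebody `H` smoothly embedded by `f` with
`f(∂H) = F = ⋂ l, S l` (`IsGKTrisection.exists_isHandlebody`), whence `∂H ≃ₜ F`; the uniqueness of
genus-`g` handlebodies (`IsHandlebody.nonempty_diffeomorph_of_oneHandle` with the proved `1`-handle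
lemma `oneHandle_nonempty_diffeomorph_holds`) gives `Φ : H ≅ V_g`, restricting to
`∂H ≃ₜ ∂V_g` (`Diffeomorph.boundaryHomeomorph`); and `∂V_g ≃ₜ {q_g + z² = c_g}`
(`FlowerModel.boundaryHomeomorph`), the flower surface by `FlowerModel.flowerSurface_def`.
No `sorry`, no named facts.  The statement is the registered stub verbatim (its `∀`-form).

References: Gay–Kirby, Geom. Topol. 20 (2016), Def. 1 and Remark 2 [GayKirby2016]; Kosinski,
*Differential Manifolds* (1993), VI (11.4)(c) [Kosinski1993]; Juhász, *Differential and
Low-Dimensional Topology* (2023), §3.5 [Juhasz2023].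
-/

set_option linter.dupNamespace false

open Set Function ContinuousMap Metric
open scoped Manifold ContDiff Topology
open Literature.Topology.FourManifolds
open Literature.AlgebraicTopology.FundamentalGroup
open Literature.AlgebraicTopology.FundamentalGroup.VanKampen
open Literature.AlgebraicTopology.Homotopy

noncomputable section

namespace Summit.SmoothPoincare4.SmoothPoincare4.Cruxes.AgkCor6Sufficiency.LpBySphereSystemSurgery

/-- The boundary of a handlebody embedded (topologically) in `X` with boundary image the central
surface `⋂ l, S l` is homeomorphic to the central surface, by the restriction of the embedding.
[cite: GayKirby2016, Def. 1 and Remark 2 (p. 3098)] -/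
private theorem nonempty_boundary_homeomorph_centralSurface {X : Type} [TopologicalSpace X]
    {S : Fin 3 → Set X} {M : Type} [TopologicalSpace M] [ChartedSpace (EuclideanHalfSpace 3) M]
    {f : M → X} (hf : Topology.IsEmbedding f) (hbd : f '' (𝓡∂ 3).boundary M = ⋂ l, S l) :
    Nonempty (↥((𝓡∂ 3).boundary M) ≃ₜ centralSurface S) :=
  ⟨(hf.comp Topology.IsEmbedding.subtypeVal).toHomeomorph.trans
    (Homeomorph.setCongr (by rw [range_comp, Subtype.range_coe, hbd]))⟩

/-- **The central surface of a balanced genus-`g ≥ 2` Gay–Kirby trisection of a closed connected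
oriented smooth `4`-manifold is homeomorphic to the flower surface** `{q_g + z² = c_g} ⊂ ℝ³`:
`F = f(∂H) ≃ₜ ∂H ≃ₜ ∂V_g ≃ₜ {q_g + z² = c_g}` for the clause-(iii) handlebody `H`
(`IsGKTrisection.exists_isHandlebody`), the uniqueness of genus-`g` handlebodies
(`IsHandlebody.nonempty_diffeomorph_of_oneHandle`, `oneHandle_nonempty_diffeomorph_holds`),
`Diffeomorph.boundaryHomeomorph` and `FlowerModel.boundaryHomeomorph`.
[cite: GayKirby2016, Def. 1 and Remark 2 (p. 3098)] [cite: Kosinski1993, VI (11.4)(c)]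
[cite: Juhasz2023, §3.5 (p. 96)] -/
theorem stub_centralSurfaceFlower : ∀ {g : ℕ} (hg : 2 ≤ g) (X : Type) [TopologicalSpace X]
    [T2Space X] [SecondCountableTopology X] [ChartedSpace (EuclideanSpace ℝ (Fin 4)) X]
    [IsManifold (𝓡 4) ∞ X] [CompactSpace X] [ConnectedSpace X] (o : SmoothOrientation (𝓡 4) X)
    (k : ℕ) (S : Fin 3 → Set X) (h : IsBalancedGKTrisection X g k S),
    Nonempty (centralSurface S ≃ₜ ↥(FlowerModel.flowerSurface g)) := by
  intro g hg X _ _ _ _ _ _ _ o k S h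
  obtain ⟨H, _, _, hM, f, hH, hf, -, hbd⟩ :=
    h.isGKTrisection.exists_isHandlebody ⟨o⟩ (show (0 : Fin 3) ≠ 1 by decide)
  haveI := hM
  haveI : T2Space H := hf.isEmbedding.t2Space
  haveI : SecondCountableTopology H := hf.isEmbedding.secondCountableTopology
  -- `∂H ≃ₜ F`
  obtain ⟨e₁⟩ := nonempty_boundary_homeomorph_centralSurface (S := S) hf.isEmbedding hbd
  -- `Φ : H ≅ V_g` (uniqueness of genus-`g` handlebodies, proved in the tree)
  obtain ⟨Φ⟩ := IsHandlebody.nonempty_diffeomorph_of_oneHandle oneHandle_nonempty_diffeomorph_holds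
    g H (FlowerModel.FlowerHandlebody hg) hH (FlowerModel.isHandlebody_flowerHandlebody hg)
  -- `∂H ≃ₜ ∂V_g`
  let e₂ : ↥((𝓡∂ 3).boundary H) ≃ₜ ↥((𝓡∂ 3).boundary (FlowerModel.FlowerHandlebody hg)) :=
    Φ.boundaryHomeomorph (by simp)
  -- `∂V_g ≃ₜ {q_g + z² = c_g} = flowerSurface g`
  let e₃ : ↥((𝓡∂ 3).boundary (FlowerModel.FlowerHandlebody hg)) ≃ₜ ↥(FlowerModel.flowerSurface g) :=
    (FlowerModel.boundaryHomeomorph hg).trans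
      (Homeomorph.setCongr (FlowerModel.flowerSurface_def (g := g)).symm)
  exact ⟨e₁.symm.trans (e₂.trans e₃)⟩

end Summit.SmoothPoincare4.SmoothPoincare4.Cruxes.AgkCor6Sufficiency.LpBySphereSystemSurgery

end
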